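import Summits.QuantumFields.BalabanUV.Beta.GAN24.SubAveragingMinimiserUnitTower
import Mathlib.Analysis.SpecificLimits.Basic

/-!
# `BalabanUV.Beta.GAN24.SubAveragingContinuumLimit` — binder row G-an2-4 ∕ (CONV-C), fibre∕strip lineage: THE FULL-SEQUENCE CONTINUUM LIMIT
# OF THE TWO SCALAR UNIT-READ CONSTITUENTS — the block-mean kernels `Kunit n` (of `G_jQ_j^*`, B4 (2.48)) and `KunitH n` (of the hard
# minimiser `H_k = 𝒢Q_k^*(Q_k𝒢Q_k^*)⁻¹`, B5 (1.103)) converge as the refinement `n → ∞` through ALL integers, at the SHARP rate `n⁻²` with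
# `n`-uniform exponential decay; in particular the limit is INDEPENDENT OF THE REFINEMENT SCHEME (every tower `n = L^j`, `L ≥ 2`, has the same limit)

NOT IN PRINT; OUR PROOF ATTEMPT (prover part P3 of row G-an2-4, fibre∕strip («Woodbury») lineage, gen 23; CRUX TEAM (2), ruling «YM REDIRECT
TOWARDS THE SUMMIT», 2026-08-21).  HONEST DEPENDENCY (cell records, verbatim): «continuum YM on T⁴ ⇐ BetaPertH ∧ nine spine estimates (0/9
proved); BetaPertH ⇐ (D1) ∧ (D4) ∧ CAP+tail; G-an2-4 gates asym, D1 and NE2/3/4.»  HONEST FRAMING (cell contract, verbatim): «discharging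
`BetaPertH` makes Bałaban's UV stability UNCONDITIONAL — a real constructive-QFT result; it is NOT the continuum limit and NOT the Clay problem.»
ABSOLUTE RULE: nothing printed is a hypothesis.  [folklore] throughout.

## Why this file
The (CONV-C) shape (`GAN24.DirichletExhaustion.ConvC`, and the two-clause theorems `SubAveragingUnitTower.unitTower_two_clauses` (p252523),
`SubAveragingMinimiserUnitTower.unitTowerH_two_clauses` (p254410)) is a CAUCHY statement ALONG ONE TOWER `n = L^j`: it gives a limit kernel
for each refinement factor `L`, a priori depending on `L`.  The fibre∕strip method proves more, and this file records it: the one-step bound holds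
between ANY two comparable refinements `n ∣ n′` with a constant depending on `n′∕n` only and an `L`-FREE decay rate (§2–§3: the strips of
`B4StripCauchy.uniformStrip_holds` ∕ `SubAveragingMinimiserKernel.strip_data` are `n`-uniform, hence refinement-free), and an elementary
argument (§1: dyadic geometric Cauchy + comparison of the towers `n·2^m` and `2^m` through the single step of factor `n`) turns such DIVISIBLE
one-step bounds into convergence of the FULL sequence with the sharp rate:
 * §1 [folklore, abstract] `norm_sub_dyadicLim_le`: if `‖F(k·L) − F(k)‖ ≤ C_L∕k²·w` for all `k, L ≥ 1` then `‖F n − F∞‖ ≤ (4∕3)·C₂∕n²·w` for EVERY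
   `n ≥ 1`, with `F∞ = dyadicLim F`; `tendsto_dyadicLim` (`F n → F∞`), `tendsto_pow_dyadicLim` (every tower `L^j`, `L ≥ 2`, tends to the SAME `F∞`).
 * §2 soft constituent: `norm_Kunit_step_le` (the `(n, L)`-level step bound, n-free constant `48^{d+1}·Ccol(L)`, `L`-free `κ`) and the END
   **`soft_continuum_limit`**: `∃ κ > 0, C ≥ 0` with (i) `‖KunitLim x‖ ≤ C e^{−κ|x|_∞}`, (ii) `‖Kunit n x − KunitLim x‖ ≤ C∕n²·e^{−κ|x|_∞}` for EVERY
   `n ≥ 1`, (iii) `Kunit n x → KunitLim x` (`n → ∞`), (iv) `Kunit (L^j) x → KunitLim x` for every `L ≥ 2` — ONE limit for all refinement schemes.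
 * §3 hard constituent: `norm_KunitH_step_le` and the END **`hard_continuum_limit`** (same four clauses for `KunitH`, constant `CU(L)`).
Summit relevance (SUMMIT-MAP heading C1, continuum UNIQUENESS = independence of the regularisation∕refinement sequence): at the free `U = 1`
level and for these two constituents the block-mean kernels have a refinement-independent limit with an explicit rate — a typed, proved
instance of the C1 shape; nothing more is claimed.

HONEST: U = 1, scalar sector, block-mean (unit-read) currency; the limit object is NAMED (`dyadicLim`) but NOT identified with a continuum
Fourier integral here; zero on the D1 grid; NOT the vector objects, NOT composites, NOT `U ≠ 1`; NEVER «G-an2-4 closed»; NOT (CONV-C) as a whole,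
NOT D1, NOT BetaPertH, NOT continuum YM, NOT Clay.  Provenance: prover-b2b-balaban-gan24-p3-g23-0 (unit `b2b-balaban-gan24-p3`, gen 23), 2026-08-21.
-/

noncomputable section

namespace Summit.QuantumFields.BalabanUV.Beta.GAN24.SubAveragingContinuumLimit

open Complex Finset MeasureTheory Filter Topology
open scoped ComplexConjugate
open Literature.MathematicalPhysics.QuantumFieldTheory.Balaban1983to89
open Literature.MathematicalPhysics.QuantumFieldTheory.Balaban1983to89.B4Strip
open Literature.MathematicalPhysics.QuantumFieldTheory.Balaban1983to89.B4StripCauchy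
open Literature.MathematicalPhysics.QuantumFieldTheory.Balaban1983to89.B4StripSums
open Literature.MathematicalPhysics.QuantumFieldTheory.Balaban1983to89.B4ContourShift
open Literature.MathematicalPhysics.QuantumFieldTheory.Balaban1983to89.B5Strip145Analytic (strip_mono)
open Summit.QuantumFields.BalabanUV.Beta.FP.ConstrainedBiLaplacianParseval (sqNorm sqNorm_nonneg)
open Summit.QuantumFields.BalabanUV.Beta.GAN24.SubAveragingFibreColumn
open Summit.QuantumFields.BalabanUV.Beta.GAN24.SubAveragingKernel
open Summit.QuantumFields.BalabanUV.Beta.GAN24.SubAveragingKernelL2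
open Summit.QuantumFields.BalabanUV.Beta.GAN24.SubAveragingUnitTower (Kunit Kunit_mul_eq norm_Kunit_le)
open Summit.QuantumFields.BalabanUV.Beta.GAN24.SubAveragingMinimiser
open Summit.QuantumFields.BalabanUV.Beta.GAN24.SubAveragingMinimiserKernel
open Summit.QuantumFields.BalabanUV.Beta.GAN24.SubAveragingMinimiserUnitTower (KunitH KunitH_sub_eq norm_KunitH_le
  stripRegular_meanD CU CU_nonneg sqrt_weights_eq)
open scoped Real

/-! ## §1 Divisible one-step bounds force convergence of the full sequence (abstract, `ℂ`-valued sequences) -/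

section Abstract

variable {F : ℕ → ℂ} {C : ℕ → ℝ} {w : ℝ}

/-- [folklore] THE DYADIC LIMIT of a sequence `F : ℕ → ℂ`: `lim_{m → ∞} F (2^m)` (a junk value if the limit does not exist). -/
def dyadicLim (F : ℕ → ℂ) : ℂ := limUnder atTop (fun m : ℕ => F (2 ^ m))

/-- [folklore] `((n·2^m : ℕ) : ℝ)² = n²·4^m`. -/
theorem cast_mul_two_pow_sq (n m : ℕ) : (((n * 2 ^ m : ℕ) : ℝ)) ^ 2 = (n : ℝ) ^ 2 * 4 ^ m := by
  push_cast
  rw [mul_pow, ← pow_mul, mul_comm m 2, pow_mul]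
  norm_num

/-- [folklore] ALONG THE DYADIC TOWER ABOVE `n`: if `‖F(k·L) − F(k)‖ ≤ C_L∕k²·w` for all `k, L ≥ 1`, then `m ↦ F (n·2^m)` converges and its limit
`ℓ` satisfies `‖F n − ℓ‖ ≤ (4∕3)·(C₂∕n²·w)` (geometric series with ratio `1∕4`). -/
theorem exists_tendsto_mul_two_pow
    (h : ∀ k L : ℕ, 1 ≤ k → 1 ≤ L → ‖F (k * L) - F k‖ ≤ C L / (k : ℝ) ^ 2 * w) {n : ℕ} (hn : 1 ≤ n) :
    ∃ ℓ : ℂ, Tendsto (fun m : ℕ => F (n * 2 ^ m)) atTop (𝓝 ℓ) ∧ ‖F n - ℓ‖ ≤ 4 / 3 * (C 2 / (n : ℝ) ^ 2 * w) := by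
  set G : ℕ → ℂ := fun m => F (n * 2 ^ m) with hG
  have hstep : ∀ m : ℕ, dist (G m) (G (m + 1)) ≤ C 2 / (n : ℝ) ^ 2 * w * (1 / 4) ^ m := by
    intro m
    have hnm : 1 ≤ n * 2 ^ m := Nat.one_le_iff_ne_zero.mpr (mul_ne_zero (by omega) (pow_ne_zero m two_ne_zero))
    have hb := h (n * 2 ^ m) 2 hnm (by norm_num)
    rw [cast_mul_two_pow_sq] at hb
    have eG : G (m + 1) = F (n * 2 ^ m * 2) := by
      show F (n * 2 ^ (m + 1)) = F (n * 2 ^ m * 2)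
      rw [pow_succ, mul_assoc]
    calc dist (G m) (G (m + 1)) = ‖F (n * 2 ^ m * 2) - F (n * 2 ^ m)‖ := by rw [dist_comm, dist_eq_norm, eG]
      _ ≤ C 2 / ((n : ℝ) ^ 2 * 4 ^ m) * w := hb
      _ = C 2 / (n : ℝ) ^ 2 * w * (1 / 4) ^ m := by rw [div_mul_eq_div_div, one_div, inv_pow]; ring
  have hCauchy : CauchySeq G := cauchySeq_of_le_geometric (1 / 4 : ℝ) (C 2 / (n : ℝ) ^ 2 * w) (by norm_num) hstep
  obtain ⟨ℓ, hℓ⟩ := cauchySeq_tendsto_of_complete hCauchy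
  refine ⟨ℓ, hℓ, ?_⟩
  have hd := dist_le_of_le_geometric_of_tendsto₀ (1 / 4 : ℝ) (C 2 / (n : ℝ) ^ 2 * w) (by norm_num) hstep hℓ
  have e0 : G 0 = F n := by simp [hG]
  rw [e0, dist_eq_norm] at hd
  calc ‖F n - ℓ‖ ≤ C 2 / (n : ℝ) ^ 2 * w / (1 - 1 / 4) := hd
    _ = 4 / 3 * (C 2 / (n : ℝ) ^ 2 * w) := by ring

/-- [folklore] **ALL DYADIC TOWERS HAVE THE SAME LIMIT**: `F (n·2^m) → dyadicLim F` for every `n ≥ 1` (compare the towers above `n` and above `1`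
through the single step of factor `n`: `‖F(2^m·n) − F(2^m)‖ ≤ C_n∕4^m·w → 0`). -/
theorem tendsto_mul_two_pow_dyadicLim
    (h : ∀ k L : ℕ, 1 ≤ k → 1 ≤ L → ‖F (k * L) - F k‖ ≤ C L / (k : ℝ) ^ 2 * w) {n : ℕ} (hn : 1 ≤ n) :
    Tendsto (fun m : ℕ => F (n * 2 ^ m)) atTop (𝓝 (dyadicLim F)) := by
  obtain ⟨ℓ₁, h₁, -⟩ := exists_tendsto_mul_two_pow h (le_refl 1)
  have h₁' : Tendsto (fun m : ℕ => F (2 ^ m)) atTop (𝓝 ℓ₁) := by simpa only [one_mul] using h₁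
  have hlim : dyadicLim F = ℓ₁ := by unfold dyadicLim; exact h₁'.limUnder_eq
  -- the difference of the two towers tends to `0`
  have hdiff : Tendsto (fun m : ℕ => F (n * 2 ^ m) - F (2 ^ m)) atTop (𝓝 0) := by
    have hg : Tendsto (fun m : ℕ => C n * w * (1 / 4 : ℝ) ^ m) atTop (𝓝 0) := by
      have hq := (tendsto_pow_atTop_nhds_zero_of_lt_one (by norm_num : (0 : ℝ) ≤ 1 / 4)
        (by norm_num : (1 : ℝ) / 4 < 1)).const_mul (C n * w)
      simpa only [mul_zero] using hq
    refine squeeze_zero_norm (fun m => ?_) hg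
    have h2m : 1 ≤ 2 ^ m := Nat.one_le_two_pow
    have hb := h (2 ^ m) n h2m hn
    have e4 : (((2 ^ m : ℕ) : ℝ)) ^ 2 = 4 ^ m := by
      push_cast
      rw [← pow_mul, mul_comm m 2, pow_mul]
      norm_num
    rw [mul_comm (2 ^ m) n, e4] at hb
    calc ‖F (n * 2 ^ m) - F (2 ^ m)‖ ≤ C n / 4 ^ m * w := hb
      _ = C n * w * (1 / 4) ^ m := by rw [one_div, inv_pow]; ring
  have hsum : Tendsto (fun m : ℕ => F (n * 2 ^ m)) atTop (𝓝 (ℓ₁ + 0)) :=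
    (h₁'.add hdiff).congr fun m => by ring
  rw [add_zero] at hsum
  rwa [hlim]

/-- [folklore] **DIVISIBLE ONE-STEP BOUNDS GIVE THE SHARP RATE TO ONE LIMIT**: if `‖F(k·L) − F(k)‖ ≤ C_L∕k²·w` for all `k, L ≥ 1` then
`‖F n − dyadicLim F‖ ≤ (4∕3)·C₂∕n²·w` for EVERY `n ≥ 1`. -/
theorem norm_sub_dyadicLim_le
    (h : ∀ k L : ℕ, 1 ≤ k → 1 ≤ L → ‖F (k * L) - F k‖ ≤ C L / (k : ℝ) ^ 2 * w) {n : ℕ} (hn : 1 ≤ n) :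
    ‖F n - dyadicLim F‖ ≤ 4 / 3 * (C 2 / (n : ℝ) ^ 2 * w) := by
  obtain ⟨ℓ, hℓ, hb⟩ := exists_tendsto_mul_two_pow h hn
  rw [tendsto_nhds_unique (tendsto_mul_two_pow_dyadicLim h hn) hℓ]
  exact hb

/-- [folklore] **THE FULL SEQUENCE CONVERGES**: `F n → dyadicLim F` as `n → ∞` through all integers. -/
theorem tendsto_dyadicLim
    (h : ∀ k L : ℕ, 1 ≤ k → 1 ≤ L → ‖F (k * L) - F k‖ ≤ C L / (k : ℝ) ^ 2 * w) :
    Tendsto F atTop (𝓝 (dyadicLim F)) := by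
  rw [tendsto_iff_norm_sub_tendsto_zero]
  have h1 : Tendsto (fun n : ℕ => ((n : ℝ) ^ 2)⁻¹) atTop (𝓝 0) :=
    tendsto_inv_atTop_zero.comp ((tendsto_pow_atTop two_ne_zero).comp tendsto_natCast_atTop_atTop)
  have hK : Tendsto (fun n : ℕ => 4 / 3 * (C 2 / (n : ℝ) ^ 2 * w)) atTop (𝓝 0) := by
    have e : (fun n : ℕ => 4 / 3 * (C 2 / (n : ℝ) ^ 2 * w)) = fun n : ℕ => (4 / 3 * C 2 * w) * ((n : ℝ) ^ 2)⁻¹ := by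
      funext n; ring
    rw [e]
    simpa only [mul_zero] using h1.const_mul (4 / 3 * C 2 * w)
  refine squeeze_zero' (Eventually.of_forall fun n => norm_nonneg _) ?_ hK
  filter_upwards [eventually_ge_atTop 1] with n hn
  exact norm_sub_dyadicLim_le h hn

/-- [folklore] **REFINEMENT INDEPENDENCE**: for every refinement factor `L ≥ 2` the tower `j ↦ F (L^j)` tends to the SAME limit `dyadicLim F`. -/
theorem tendsto_pow_dyadicLim
    (h : ∀ k L : ℕ, 1 ≤ k → 1 ≤ L → ‖F (k * L) - F k‖ ≤ C L / (k : ℝ) ^ 2 * w) {L : ℕ} (hL : 2 ≤ L) :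
    Tendsto (fun j : ℕ => F (L ^ j)) atTop (𝓝 (dyadicLim F)) :=
  (tendsto_dyadicLim h).comp (tendsto_pow_atTop_atTop_of_one_lt (by omega : 1 < L))

end Abstract

variable {d : ℕ}

/-! ## §2 The soft constituent `G_jQ_j^*` (B4 (2.48)): the `(n, L)`-level step bound and the continuum limit -/

/-- [folklore] the TOTAL extension of the unit-read kernel to all `n : ℕ` (junk `0` at `n = 0`), as a sequence in `n` at fixed `(a, m², x)`. -/
def KunitT (a m2 : ℝ) (x : Fin (d + 1) → ℤ) (n : ℕ) : ℂ :=
  if h : n = 0 then 0 else @Kunit d n ⟨h⟩ a m2 x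

/-- [folklore] `KunitT` agrees with `Kunit` at every `n ≥ 1`. -/
theorem KunitT_eq (a m2 : ℝ) (x : Fin (d + 1) → ℤ) (n : ℕ) [NeZero n] : KunitT a m2 x n = Kunit n a m2 x := by
  unfold KunitT
  rw [dif_neg (NeZero.ne n)]

/-- [folklore] **THE CONTINUUM UNIT-READ KERNEL** of `G_jQ_j^*`: the dyadic limit of `n ↦ Kunit n a m2 x` (by `soft_continuum_limit` it is the
limit of the FULL sequence, hence of every refinement tower). -/
def KunitLim (a m2 : ℝ) (x : Fin (d + 1) → ℤ) : ℂ := dyadicLim (KunitT (d := d) a m2 x)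

/-- [folklore] **THE `(n, L)`-LEVEL ONE-STEP BOUND WITH AN `n`-FREE CONSTANT AND A REFINEMENT-FREE RATE**: given the common lower bound `c ≤ ‖E‖`
on the strip of width `κ ≤ rOf` at the two levels `n` and `n·L`,
`‖Kunit (n·L) x − Kunit n x‖ ≤ 48^{d+1}·Ccol(L)∕n² · e^{−κ|x|_∞}` (gen 22's Parseval pairing `stripRegular_PhiD` at the test vector `f ≡ 1`). -/
theorem norm_Kunit_step_le (n L : ℕ) [NeZero n] [NeZero L] (a m2 : ℝ) (ha : 0 ≤ a) (hm : 0 ≤ m2) {κ c : ℝ}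
    (hκ0 : 0 ≤ κ) (hκr : κ ≤ rOf (d + 1)) (hc : 0 < c)
    (hE : ∀ p ∈ Strip (d + 1) κ, c ≤ ‖E n a m2 p‖) (hE' : ∀ p ∈ Strip (d + 1) κ, c ≤ ‖E (n * L) a m2 p‖)
    (x : Fin (d + 1) → ℤ) :
    ‖Kunit (n * L) a m2 x - Kunit n a m2 x‖
      ≤ 48 ^ (d + 1) * Ccol (d + 1) L a m2 c / (n : ℝ) ^ 2 * Real.exp (-(κ * supNorm x)) := by
  -- (1) per coarse fine site: sub-cell average minus coarse kernel = kernel of the difference multiplier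
  have e : ∀ τ : Fin (d + 1) → Fin n,
      ((L : ℂ) ^ (d + 1))⁻¹ * ∑ ρ : Fin (d + 1) → Fin L, latticeKernel (G (n * L) a m2 (Tsub n L τ ρ)) x
          - latticeKernel (G n a m2 τ) x = latticeKernel (Dmult n L a m2 τ) x := by
    intro τ
    rw [← latticeKernel_avgG n L a m2 m2 hm le_rfl τ hκ0 hκr hc hE' x]
    have hint1 := (stripRegular_avgG n L a m2 m2 hm le_rfl τ hκ0 hκr hc hE').integrableOn hκ0 x
    have hint2 := (stripRegular_G n a m2 m2 hm le_rfl τ hκ0 hκr hc hE).integrableOn hκ0 x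
    unfold latticeKernel fourierBox
    rw [← smul_sub, ← integral_sub hint1 hint2]
    congr 1
    refine setIntegral_congr_fun (by unfold BZ; exact measurableSet_Icc) fun q _ => ?_
    simp only [integrand, Dmult]
    ring
  -- (2) the difference of the block means is the block mean of those kernels = the pairing against `f ≡ 1`, scaled by `n^{−(d+1)}`
  have e1 : Kunit (n * L) a m2 x - Kunit n a m2 x
      = ((n : ℂ) ^ (d + 1))⁻¹ * latticeKernel (PhiD n L a m2 (fun _ => (1 : ℂ))) x := by
    rw [latticeKernel_PhiD n L a m2 m2 ha hm le_rfl hκ0 hκr hc hE hE' (fun _ => (1 : ℂ)) x, Kunit_mul_eq]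
    unfold Kunit
    rw [← mul_sub, ← Finset.sum_sub_distrib]
    congr 1
    refine Finset.sum_congr rfl fun τ _ => ?_
    simp only [map_one, one_mul]
    exact e τ
  rw [e1, norm_mul, norm_inv, norm_pow, Complex.norm_natCast]
  have hreg := stripRegular_PhiD n L a m2 m2 ha hm le_rfl hκ0 hκr hc hE hE' (fun _ => (1 : ℂ))
  have hdec := latticeKernel_decay hreg hκ0 x
  have esq : sqNorm (fun _ : Fin (d + 1) → Fin n => (1 : ℂ)) = (n : ℝ) ^ (d + 1) := by
    unfold sqNorm
    simp
  rw [esq, sqrt_weights_eq] at hdec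
  have hn0 : (0 : ℝ) < n := by exact_mod_cast Nat.pos_of_ne_zero (NeZero.ne n)
  have hnpow : (0 : ℝ) < (n : ℝ) ^ (d + 1) := by positivity
  rw [inv_mul_le_iff₀ hnpow]
  calc ‖latticeKernel (PhiD n L a m2 fun _ => (1 : ℂ)) x‖
      ≤ Ccol (d + 1) L a m2 c / (n : ℝ) ^ 2 * ((n : ℝ) ^ (d + 1) * 48 ^ (d + 1)) * Real.exp (-(κ * supNorm x)) := hdec
    _ = (n : ℝ) ^ (d + 1) * (48 ^ (d + 1) * Ccol (d + 1) L a m2 c / (n : ℝ) ^ 2 * Real.exp (-(κ * supNorm x))) := by ring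

/-- [folklore] **THE CONTINUUM LIMIT OF THE SOFT UNIT-READ KERNELS — EXISTENCE, SHARP RATE, DECAY, REFINEMENT INDEPENDENCE.**  For every `a > 0`,
`m² ≥ 0` there are `κ > 0`, `C ≥ 0` such that
 (i) `‖KunitLim x‖ ≤ C·e^{−κ|x|_∞}`;  (ii) for EVERY `n ≥ 1`: `‖Kunit n x − KunitLim x‖ ≤ C∕n²·e^{−κ|x|_∞}`;
 (iii) `Kunit n x → KunitLim x` as `n → ∞` (all integers);  (iv) for every `L ≥ 2`: `Kunit (L^j) x → KunitLim x` — the SAME limit for every tower. -/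
theorem soft_continuum_limit (d : ℕ) (a m2 : ℝ) (ha : 0 < a) (hm : 0 ≤ m2) :
    ∃ κ C : ℝ, 0 < κ ∧ 0 ≤ C ∧
      (∀ x : Fin (d + 1) → ℤ, ‖KunitLim a m2 x‖ ≤ C * Real.exp (-(κ * supNorm x))) ∧
      (∀ (n : ℕ) [NeZero n] (x : Fin (d + 1) → ℤ),
        ‖Kunit n a m2 x - KunitLim a m2 x‖ ≤ C / (n : ℝ) ^ 2 * Real.exp (-(κ * supNorm x))) ∧
      (∀ x : Fin (d + 1) → ℤ, Tendsto (KunitT a m2 x) atTop (𝓝 (KunitLim a m2 x))) ∧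
      (∀ L : ℕ, 2 ≤ L → ∀ x : Fin (d + 1) → ℤ,
        Tendsto (fun j : ℕ => KunitT a m2 x (L ^ j)) atTop (𝓝 (KunitLim a m2 x))) := by
  obtain ⟨κ₁, M, hκ₁, hM, h1⟩ := kernel248_decay d a a m2 ha
  obtain ⟨κ₂, c, hκ₂, hc, h2⟩ := uniformStrip_holds (d + 1) a a m2 ha
  set κ : ℝ := min κ₁ (min κ₂ (rOf (d + 1))) with hκ
  have hκpos : 0 < κ := lt_min hκ₁ (lt_min hκ₂ (rOf_pos _))
  have hκ0 : 0 ≤ κ := hκpos.le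
  have hκr : κ ≤ rOf (d + 1) := (min_le_right _ _).trans (min_le_right _ _)
  have hκ2 : κ ≤ κ₂ := (min_le_right _ _).trans (min_le_left _ _)
  have hκ1 : κ ≤ κ₁ := min_le_left _ _
  have hE : ∀ (n : ℕ) [NeZero n], ∀ p ∈ Strip (d + 1) κ, c ≤ ‖E n a m2 p‖ := fun n _ p hp =>
    h2 n a m2 le_rfl le_rfl hm le_rfl p (strip_mono hκ2 hp)
  -- the step constants `C_L`
  set Cst : ℕ → ℝ := fun L => 48 ^ (d + 1) * Ccol (d + 1) L a m2 c with hCst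
  have hCst0 : ∀ L, 0 ≤ Cst L := fun L => by
    have := Ccol_nonneg (d + 1) L ha.le hm hc
    simp only [hCst]
    positivity
  -- the divisible one-step bounds for the total extension, pointwise in `x`
  have hstep : ∀ (x : Fin (d + 1) → ℤ) (k L : ℕ), 1 ≤ k → 1 ≤ L →
      ‖KunitT a m2 x (k * L) - KunitT a m2 x k‖ ≤ Cst L / (k : ℝ) ^ 2 * Real.exp (-(κ * supNorm x)) := by
    intro x k L hk hL
    haveI : NeZero k := ⟨by omega⟩
    haveI : NeZero L := ⟨by omega⟩
    rw [KunitT_eq a m2 x (k * L), KunitT_eq a m2 x k]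
    exact norm_Kunit_step_le k L a m2 ha.le hm hκ0 hκr hc (hE k) (hE (k * L)) x
  refine ⟨κ, M + 4 / 3 * Cst 2, hκpos, add_nonneg hM (mul_nonneg (by norm_num) (hCst0 2)), ?_, ?_, ?_, ?_⟩
  · -- (i) decay of the limit: through level `n = 1`
    intro x
    have hb := norm_sub_dyadicLim_le (hstep x) (le_refl 1)
    simp only [Nat.cast_one, one_pow, div_one] at hb
    have h1x : ‖KunitT a m2 x 1‖ ≤ M * Real.exp (-(κ * supNorm x)) := by
      rw [KunitT_eq a m2 x 1]
      refine (norm_Kunit_le 1 a m2 (fun τ x => h1 1 a m2 le_rfl le_rfl hm le_rfl τ x) x).trans ?_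
      exact mul_le_mul_of_nonneg_left (Real.exp_le_exp.mpr (by nlinarith [hκ1, supNorm_nonneg x])) hM
    calc ‖KunitLim a m2 x‖ = ‖KunitT a m2 x 1 - (KunitT a m2 x 1 - KunitLim a m2 x)‖ := by rw [sub_sub_cancel]
      _ ≤ ‖KunitT a m2 x 1‖ + ‖KunitT a m2 x 1 - KunitLim a m2 x‖ := norm_sub_le _ _
      _ ≤ M * Real.exp (-(κ * supNorm x)) + 4 / 3 * (Cst 2 * Real.exp (-(κ * supNorm x))) := add_le_add h1x hb
      _ = (M + 4 / 3 * Cst 2) * Real.exp (-(κ * supNorm x)) := by ring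
  · -- (ii) the sharp rate at every `n`
    intro n _ x
    have hn : 1 ≤ n := Nat.one_le_iff_ne_zero.mpr (NeZero.ne n)
    have hb := norm_sub_dyadicLim_le (hstep x) hn
    rw [KunitT_eq a m2 x n] at hb
    calc ‖Kunit n a m2 x - KunitLim a m2 x‖ ≤ 4 / 3 * (Cst 2 / (n : ℝ) ^ 2 * Real.exp (-(κ * supNorm x))) := hb
      _ = (4 / 3 * Cst 2) / (n : ℝ) ^ 2 * Real.exp (-(κ * supNorm x)) := by ring
      _ ≤ (M + 4 / 3 * Cst 2) / (n : ℝ) ^ 2 * Real.exp (-(κ * supNorm x)) := by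
          gcongr
          linarith
  · -- (iii) the full sequence converges
    intro x
    exact tendsto_dyadicLim (hstep x)
  · -- (iv) every refinement tower has the same limit
    intro L hL x
    exact tendsto_pow_dyadicLim (hstep x) hL

/-! ## §3 The hard minimiser `H_k` (B5 (1.103)): the `(n, L)`-level step bound and the continuum limit -/

/-- [folklore] the TOTAL extension of the unit-read minimiser kernel to all `n : ℕ` (junk `0` at `n = 0`). -/
def KunitHT (x : Fin (d + 1) → ℤ) (n : ℕ) : ℂ :=
  if h : n = 0 then 0 else @KunitH d n ⟨h⟩ x

/-- [folklore] `KunitHT` agrees with `KunitH` at every `n ≥ 1`. -/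
theorem KunitHT_eq (x : Fin (d + 1) → ℤ) (n : ℕ) [NeZero n] : KunitHT x n = KunitH n x := by
  unfold KunitHT
  rw [dif_neg (NeZero.ne n)]

/-- [folklore] **THE CONTINUUM UNIT-READ KERNEL** of the hard minimiser: the dyadic limit of `n ↦ KunitH n x`. -/
def KunitHLim (x : Fin (d + 1) → ℤ) : ℂ := dyadicLim (KunitHT (d := d) x)

/-- [folklore] **THE `(n, L)`-LEVEL ONE-STEP BOUND FOR THE MINIMISER** with the n-free constant `CU(L)` and a refinement-free rate: given the
soft and hard lower bounds `c`, `c_F` on the strip of width `κ ≤ rOf` at the levels `n` and `n·L`,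
`‖KunitH (n·L) x − KunitH n x‖ ≤ CU(L)∕n² · e^{−κ|x|_∞}` (FILE C's `KunitH_sub_eq` + `stripRegular_meanD`). -/
theorem norm_KunitH_step_le (n L : ℕ) [NeZero n] [NeZero L] {κ c cF : ℝ} (hκ0 : 0 ≤ κ) (hκr : κ ≤ rOf (d + 1))
    (hc : 0 < c) (hcF : 0 < cF)
    (hE : ∀ p ∈ Strip (d + 1) κ, c ≤ ‖E n 1 0 p‖) (hE' : ∀ p ∈ Strip (d + 1) κ, c ≤ ‖E (n * L) 1 0 p‖)
    (hF : ∀ p ∈ Strip (d + 1) κ, cF ≤ ‖E n 1 0 p - DeltaXi n 0 p‖)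
    (hF' : ∀ p ∈ Strip (d + 1) κ, cF ≤ ‖E (n * L) 1 0 p - DeltaXi (n * L) 0 p‖) (x : Fin (d + 1) → ℤ) :
    ‖KunitH (n * L) x - KunitH n x‖ ≤ CU (d + 1) L c cF / (n : ℝ) ^ 2 * Real.exp (-(κ * supNorm x)) := by
  rw [KunitH_sub_eq n L hκ0 hκr hc hcF hE hE' hF hF' x]
  exact latticeKernel_decay (stripRegular_meanD n L hκ0 hκr hc hcF hE hE' hF hF') hκ0 x

/-- [folklore] **THE CONTINUUM LIMIT OF THE HARD-MINIMISER UNIT-READ KERNELS — EXISTENCE, SHARP RATE, DECAY, REFINEMENT INDEPENDENCE.**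
There are `κ > 0`, `C ≥ 0` (depending on `d` only) such that
 (i) `‖KunitHLim x‖ ≤ C·e^{−κ|x|_∞}`;  (ii) for EVERY `n ≥ 1`: `‖KunitH n x − KunitHLim x‖ ≤ C∕n²·e^{−κ|x|_∞}`;
 (iii) `KunitH n x → KunitHLim x` as `n → ∞`;  (iv) for every `L ≥ 2`: `KunitH (L^j) x → KunitHLim x` — the SAME limit for every tower. -/
theorem hard_continuum_limit (d : ℕ) :
    ∃ κ C : ℝ, 0 < κ ∧ 0 ≤ C ∧
      (∀ x : Fin (d + 1) → ℤ, ‖KunitHLim x‖ ≤ C * Real.exp (-(κ * supNorm x))) ∧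
      (∀ (n : ℕ) [NeZero n] (x : Fin (d + 1) → ℤ),
        ‖KunitH n x - KunitHLim x‖ ≤ C / (n : ℝ) ^ 2 * Real.exp (-(κ * supNorm x))) ∧
      (∀ x : Fin (d + 1) → ℤ, Tendsto (KunitHT x) atTop (𝓝 (KunitHLim x))) ∧
      (∀ L : ℕ, 2 ≤ L → ∀ x : Fin (d + 1) → ℤ,
        Tendsto (fun j : ℕ => KunitHT x (L ^ j)) atTop (𝓝 (KunitHLim x))) := by
  obtain ⟨κ₁, M, hκ₁, hM, h1⟩ := minimiser_kernel_decay d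
  obtain ⟨κ₂, c, cF, hκ₂, hκ₂r, hc, hcF, h2⟩ := strip_data (d + 1)
  set κ : ℝ := min κ₁ κ₂ with hκ
  have hκpos : 0 < κ := lt_min hκ₁ hκ₂
  have hκ0 : 0 ≤ κ := hκpos.le
  have hκr : κ ≤ rOf (d + 1) := (min_le_right _ _).trans hκ₂r
  have hκ1 : κ ≤ κ₁ := min_le_left _ _
  have hsub : Strip (d + 1) κ ⊆ Strip (d + 1) κ₂ := strip_mono (min_le_right _ _)
  have hE : ∀ (n : ℕ) [NeZero n], ∀ p ∈ Strip (d + 1) κ, c ≤ ‖E n 1 0 p‖ := fun n _ p hp => (h2 n).1 p (hsub hp)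
  have hF : ∀ (n : ℕ) [NeZero n], ∀ p ∈ Strip (d + 1) κ, cF ≤ ‖E n 1 0 p - DeltaXi n 0 p‖ := fun n _ p hp =>
    (h2 n).2 p (hsub hp)
  set Cst : ℕ → ℝ := fun L => CU (d + 1) L c cF with hCst
  have hCst0 : ∀ L, 0 ≤ Cst L := fun L => CU_nonneg (d + 1) L hc hcF
  have hstep : ∀ (x : Fin (d + 1) → ℤ) (k L : ℕ), 1 ≤ k → 1 ≤ L →
      ‖KunitHT x (k * L) - KunitHT x k‖ ≤ Cst L / (k : ℝ) ^ 2 * Real.exp (-(κ * supNorm x)) := by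
    intro x k L hk hL
    haveI : NeZero k := ⟨by omega⟩
    haveI : NeZero L := ⟨by omega⟩
    rw [KunitHT_eq x (k * L), KunitHT_eq x k]
    exact norm_KunitH_step_le k L hκ0 hκr hc hcF (hE k) (hE (k * L)) (hF k) (hF (k * L)) x
  refine ⟨κ, M + 4 / 3 * Cst 2, hκpos, add_nonneg hM (mul_nonneg (by norm_num) (hCst0 2)), ?_, ?_, ?_, ?_⟩
  · intro x
    have hb := norm_sub_dyadicLim_le (hstep x) (le_refl 1)
    simp only [Nat.cast_one, one_pow, div_one] at hb
    have h1x : ‖KunitHT x 1‖ ≤ M * Real.exp (-(κ * supNorm x)) := by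
      rw [KunitHT_eq x 1]
      refine (norm_KunitH_le 1 (fun τ x => h1 1 τ x) x).trans ?_
      exact mul_le_mul_of_nonneg_left (Real.exp_le_exp.mpr (by nlinarith [hκ1, supNorm_nonneg x])) hM
    calc ‖KunitHLim x‖ = ‖KunitHT x 1 - (KunitHT x 1 - KunitHLim x)‖ := by rw [sub_sub_cancel]
      _ ≤ ‖KunitHT x 1‖ + ‖KunitHT x 1 - KunitHLim x‖ := norm_sub_le _ _
      _ ≤ M * Real.exp (-(κ * supNorm x)) + 4 / 3 * (Cst 2 * Real.exp (-(κ * supNorm x))) := add_le_add h1x hb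
      _ = (M + 4 / 3 * Cst 2) * Real.exp (-(κ * supNorm x)) := by ring
  · intro n _ x
    have hn : 1 ≤ n := Nat.one_le_iff_ne_zero.mpr (NeZero.ne n)
    have hb := norm_sub_dyadicLim_le (hstep x) hn
    rw [KunitHT_eq x n] at hb
    calc ‖KunitH n x - KunitHLim x‖ ≤ 4 / 3 * (Cst 2 / (n : ℝ) ^ 2 * Real.exp (-(κ * supNorm x))) := hb
      _ = (4 / 3 * Cst 2) / (n : ℝ) ^ 2 * Real.exp (-(κ * supNorm x)) := by ring
      _ ≤ (M + 4 / 3 * Cst 2) / (n : ℝ) ^ 2 * Real.exp (-(κ * supNorm x)) := by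
          gcongr
          linarith
  · intro x
    exact tendsto_dyadicLim (hstep x)
  · intro L hL x
    exact tendsto_pow_dyadicLim (hstep x) hL

end Summit.QuantumFields.BalabanUV.Beta.GAN24.SubAveragingContinuumLimit
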